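import Literature.NumberTheory.EllipticCurves.HeegnerPointsSingularModuliField
import Literature.NumberTheory.EllipticCurves.HeegnerPointReflectionProofs
import Literature.NumberTheory.EllipticCurves.ComplexMultiplicationClassPolynomialIrreducibleProofs
import HarnessLib

set_option linter.dupNamespace false -- namespace `…BirchSwinnertonDyer.BirchSwinnertonDyer…` is the cell's (D-0017 nested layout)
set_option autoImplicit false

/-!
# Twin″ (item 19140), LINE U, file U2a — toolkit for the EXPLICIT CLASS step: roots of unity under field automorphisms,
# and the complex embeddings of the field of singular moduli `H_K`

Cell `bsd-goldfeld`, seat `bsd-goldfeld-s1p-c301` (prover, gen 14); ORDER «LINE U — UNIT CIRCLE on 𝒮|σ=−1» (planner (cliii));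
`--supports stmt-BirchSwinnertonDyer-19140` (twin″) as a HELPER; memo `HOME/INERT7-UNIT-CIRCLE.md` §3. FACT-FREE, Heegner-free.
§1 Two lemmas on a root of unity `ζ` (`ζⁿ = 1`) in a field `L` and a ring endomorphism `σ`: `σ ζ / ζ` is a square
(`isSquare_map_div_of_pow_eq_one`: `σ ζ = ζᵏ` with `k` odd when `ord ζ` is even), and if `σ ζ = ζ⁻¹` while `σ` fixes a square root `j`
of `−1` then `ζ` is a square (`isSquare_of_pow_eq_one_of_map_eq_inv`: `4 ∤ ord ζ`, else `ζ^{ord/4} = ±j` would be inverted by `σ`).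
§2 Embeddings of `H_K = singularModuliField K ι` (`K` imaginary quadratic): every complex embedding of `K` is `ι` or `conj ∘ ι`
(`ringHom_eq_or_eq_conjugate`); a `K`-embedding `H_K → ℂ` lands in `H_K` (normality of `H_K/K`, tree
`finiteDimensional_and_isGalois_singularModuliField`) and is an automorphism (`exists_algEquiv_of_ringHom_comp_eq`); hence for EVERY
`φ : H_K →+* ℂ` there is `σ ∈ Gal(H_K/K)` with `‖φ x‖ = ‖σ x‖` for all `x` (`exists_algEquiv_norm_eq_of_ringHom`) — the input that turns
file U1's unit circle at the given embedding into «all conjugates have modulus `7^{m/2}`», i.e. Kronecker's theorem applies (file U2b).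
HONEST FRAMING: field theory only; nothing about Heegner points, `L`-values or BSD.
References: S. Lang, *Algebra*, VI §1 (normal extensions), [Lang2002]; D. A. Cox, *Primes of the form x² + ny²* (2013), §5–§9
(the Hilbert class field is Galois) [Cox2013].
-/

noncomputable section

open scoped Classical

open Complex NumberField Polynomial
open Literature.NumberTheory.EllipticCurves

namespace Summit.BirchSwinnertonDyer.BirchSwinnertonDyer.Theorems.GoldfeldGoodTwists

/-! ## §1 Roots of unity moved by a field automorphism -/

/-- **`σ(ζ)/ζ` is a square** for a root of unity `ζ` (`ζⁿ = 1`, `n > 0`) and a ring endomorphism `σ` of a field: `σ ζ = ζᵏ` with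
`gcd(k, ord ζ) = 1`, so `k` is odd when `ord ζ` is even (`σζ/ζ = (ζ^{(k−1)/2})²`), and every power of `ζ` is a square when `ord ζ` is odd.
[cite: Lang2002, VI §1] -/
theorem isSquare_map_div_of_pow_eq_one {L : Type*} [Field L] (σ : L →+* L) {ζ : L} {n : ℕ} (hn : 0 < n)
    (hζ : ζ ^ n = 1) : IsSquare (σ ζ / ζ) := by
  have hζ0 : ζ ≠ 0 := fun h ↦ by rw [h, zero_pow hn.ne'] at hζ; exact zero_ne_one hζ
  -- `ζ` is a primitive `d`-th root of unity, `d = orderOf ζ`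
  set d := orderOf ζ with hd
  have hd0 : 0 < d := orderOf_pos_iff.mpr (isOfFinOrder_iff_pow_eq_one.mpr ⟨n, hn, hζ⟩)
  haveI : NeZero d := ⟨hd0.ne'⟩
  have hprim : IsPrimitiveRoot ζ d := IsPrimitiveRoot.orderOf ζ
  -- `σ ζ = ζ ^ i` with `i` coprime to `d`
  have hσζ : (σ ζ) ^ d = 1 := by rw [← map_pow, hprim.pow_eq_one, map_one]
  obtain ⟨i, hid, hi⟩ := hprim.eq_pow_of_pow_eq_one hσζ
  have hprim' : IsPrimitiveRoot (σ ζ) d := hprim.map_of_injective σ.injective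
  rw [← hi] at hprim'
  have hcop : i.Coprime d := (hprim.pow_iff_coprime hd0 i).mp hprim'
  rcases Nat.even_or_odd d with ⟨e, he⟩ | hodd
  · -- `d` even ⇒ `i` odd ⇒ `σ ζ / ζ = ζ^(i-1)` is a square
    have hi_odd : Odd i := by
      by_contra h
      rw [Nat.not_odd_iff_even] at h
      have h2 : 2 ∣ Nat.gcd i d := Nat.dvd_gcd (even_iff_two_dvd.mp h) ⟨e, by omega⟩
      rw [hcop] at h2
      omega
    obtain ⟨k, hk⟩ := hi_odd
    refine ⟨ζ ^ k, ?_⟩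
    rw [← hi, hk, div_eq_iff hζ0, ← pow_add, ← pow_succ]
    ring_nf
  · -- `d` odd ⇒ every power of `ζ` is a square
    obtain ⟨e, he⟩ := hodd
    have hsq : ζ = (ζ ^ (e + 1)) ^ 2 := by
      rw [← pow_mul, show (e + 1) * 2 = d + 1 by omega, pow_succ, hprim.pow_eq_one, one_mul]
    refine ⟨(ζ ^ (e + 1)) ^ i / ζ ^ (e + 1), ?_⟩
    rw [← hi]
    conv_lhs => rw [hsq]
    rw [← pow_mul, mul_comm 2 i, pow_mul, div_mul_div_comm, ← sq, ← sq]

/-- **A root of unity inverted by an automorphism that fixes `√−1` is a square**: if `ζⁿ = 1`, `σ ζ = ζ⁻¹`, `j² = −1`, `σ j = j` (char. `0`),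
then `IsSquare ζ` — `4 ∤ ord ζ` (else `ζ^{ord/4} = ±j` would satisfy `σ x = x⁻¹ = −x`), and for `ord ζ = 2e`, `e` odd, `ζ = (j·ζ^{(e+1)/2})²`.
[cite: Lang2002, VI §1] -/
theorem isSquare_of_pow_eq_one_of_map_eq_inv {L : Type*} [Field L] [CharZero L] (σ : L →+* L) {ζ j : L}
    {n : ℕ} (hn : 0 < n) (hζ : ζ ^ n = 1) (hσ : σ ζ = ζ⁻¹) (hj : j ^ 2 = -1) (hσj : σ j = j) :
    IsSquare ζ := by
  have hζ0 : ζ ≠ 0 := fun h ↦ by rw [h, zero_pow hn.ne'] at hζ; exact zero_ne_one hζ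
  set d := orderOf ζ with hd
  have hd0 : 0 < d := orderOf_pos_iff.mpr (isOfFinOrder_iff_pow_eq_one.mpr ⟨n, hn, hζ⟩)
  have hprim : IsPrimitiveRoot ζ d := IsPrimitiveRoot.orderOf ζ
  rcases Nat.even_or_odd d with ⟨e, he⟩ | ⟨e, he⟩
  · -- `d = 2e`; `ζ^e = −1`
    have he0 : 0 < e := by omega
    have hζe : ζ ^ e = -1 := by
      have hsq : (ζ ^ e) ^ 2 = 1 := by rw [← pow_mul, show e * 2 = d by omega, hprim.pow_eq_one]
      have hsq' : ζ ^ e * ζ ^ e = 1 := by rw [← sq]; exact hsq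
      rcases mul_self_eq_one_iff.mp hsq' with h1 | h1
      · exact absurd (hprim.pow_eq_one_iff_dvd e |>.mp h1) (by
          intro hdvd; have := Nat.le_of_dvd he0 hdvd; omega)
      · exact h1
    rcases Nat.even_or_odd e with ⟨f, hf⟩ | ⟨f, hf⟩
    · -- `4 ∣ d`: then `ζ^f` is a square root of `−1` inverted by `σ`, contradiction
      exfalso
      have hζf : (ζ ^ f) ^ 2 = -1 := by rw [← pow_mul, show f * 2 = e by omega, hζe]
      have hjf : ζ ^ f = j ∨ ζ ^ f = -j := by
        have : (ζ ^ f) ^ 2 = j ^ 2 := by rw [hζf, hj]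
        exact sq_eq_sq_iff_eq_or_eq_neg.mp this
      have hσf : σ (ζ ^ f) = (ζ ^ f)⁻¹ := by rw [map_pow, hσ, inv_pow]
      have hinv : (ζ ^ f)⁻¹ = -(ζ ^ f) := by
        rw [inv_eq_iff_eq_inv, ← neg_inv, inv_eq_of_mul_eq_one_right]
        · rw [← neg_eq_iff_eq_neg]
        · rw [mul_neg, ← sq, hζf, neg_neg]
      have hfix : σ (ζ ^ f) = ζ ^ f := by
        rcases hjf with h | h
        · rw [h, hσj]
        · rw [h, map_neg, hσj]
      rw [hfix, hinv] at hσf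
      have h2 : (2 : L) * ζ ^ f = 0 := by linear_combination hσf
      rcases mul_eq_zero.mp h2 with h | h
      · exact two_ne_zero h
      · exact hζ0 (pow_eq_zero_iff (by omega) |>.mp h)
    · -- `e` odd: `ζ = −ζ^{e+1} = (j ζ^{(e+1)/2})²`
      refine ⟨j * ζ ^ (f + 1), ?_⟩
      have : ζ ^ (e + 1) = -ζ := by rw [pow_succ, hζe, neg_one_mul]
      rw [← sq, mul_pow, hj, ← pow_mul, show (f + 1) * 2 = e + 1 by omega, this]
      ring
  · -- `d` odd
    refine ⟨ζ ^ (e + 1), ?_⟩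
    rw [← sq, ← pow_mul, show (e + 1) * 2 = d + 1 by omega, pow_succ, hprim.pow_eq_one, one_mul]

/-! ## §2 Embeddings of the field of singular moduli -/

variable {K : Type*} [Field K] [NumberField K]

/-- Every complex embedding of an imaginary quadratic field `K` is `ι` or `conj ∘ ι` (two embeddings, `ι` not real). [folklore] -/
theorem ringHom_eq_or_eq_conjugate (hK : IsImaginaryQuadratic K) (ι ψ : K →+* ℂ) :
    ψ = ι ∨ ψ = NumberField.ComplexEmbedding.conjugate ι := by
  haveI := hK.2
  by_contra h
  rw [not_or] at h
  have hne : NumberField.ComplexEmbedding.conjugate ι ≠ ι := by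
    intro hc
    exact NumberField.IsTotallyComplex.complexEmbedding_not_isReal ι
      (NumberField.ComplexEmbedding.isReal_iff.mpr hc)
  have hcard : Fintype.card (K →+* ℂ) = 2 := by rw [NumberField.Embeddings.card, hK.finrank_eq_two]
  have h3 : ({ψ, ι, NumberField.ComplexEmbedding.conjugate ι} : Finset (K →+* ℂ)).card ≤ 2 :=
    hcard ▸ Finset.card_le_univ _
  rw [Finset.card_insert_of_notMem (by simp [h.1, h.2]), Finset.card_pair hne.symm] at h3
  omega

/-- **A `K`-embedding `φ : H_K → ℂ` is `incl ∘ σ` for an automorphism `σ ∈ Gal(H_K/K)`**: `H_K/K` is normal (tree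
`finiteDimensional_and_isGalois_singularModuliField`), so `φ(x)`, a root of the minimal polynomial of `x`, lies in `H_K`
(`Polynomial.Splits.image_rootSet`), and the induced `K`-endomorphism of the finite extension `H_K` is bijective. [cite: Lang2002, VI §1] -/
theorem exists_algEquiv_of_ringHom_comp_eq (hK : IsImaginaryQuadratic K) (ι : K →+* ℂ)
    (φ : singularModuliField K ι →+* ℂ)
    (hφ : ∀ k : K, φ (algebraMap K (singularModuliField K ι) k) = ι k) :
    ∃ σ : singularModuliField K ι ≃ₐ[K] singularModuliField K ι,
      ∀ x, φ x = ((σ x : singularModuliField K ι) : ℂ) := by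
  obtain ⟨hfd, hgal⟩ := finiteDimensional_and_isGalois_singularModuliField irreducible_classPolynomial_holds hK ι
  haveI := hfd
  haveI := hgal
  letI : Algebra K ℂ := ι.toAlgebra
  -- the two `K`-algebra maps `H_K → ℂ`
  let incl : singularModuliField K ι →ₐ[K] ℂ := { (singularModuliField K ι).subtype with commutes' := fun k ↦ rfl }
  let φₐ : singularModuliField K ι →ₐ[K] ℂ := { φ with commutes' := hφ }
  -- `φ(H_K) ⊆ H_K` by normality
  have hmem : ∀ x : singularModuliField K ι, φ x ∈ singularModuliField K ι := fun x ↦ by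
    have hsplit := Normal.splits (inferInstance : Normal K (singularModuliField K ι)) x
    have hroot : φₐ x ∈ (minpoly K x).rootSet ℂ := by
      rw [Polynomial.mem_rootSet']
      refine ⟨Polynomial.map_ne_zero (minpoly.ne_zero (IsIntegral.of_finite K x)), ?_⟩
      rw [Polynomial.aeval_algHom_apply, minpoly.aeval, map_zero]
    rw [← hsplit.image_rootSet incl] at hroot
    obtain ⟨y, -, hy⟩ := hroot
    change (y : ℂ) = φ x at hy
    rw [← hy]; exact y.2
  -- the induced `K`-endomorphism of `H_K`, an automorphism
  let ψ : singularModuliField K ι →ₐ[K] singularModuliField K ι :=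
    { toFun := fun x ↦ ⟨φ x, hmem x⟩
      map_one' := Subtype.ext (by simp)
      map_mul' := fun x y ↦ Subtype.ext (by simp)
      map_zero' := Subtype.ext (by simp)
      map_add' := fun x y ↦ Subtype.ext (by simp)
      commutes' := fun k ↦ Subtype.ext (hφ k) }
  have hψ : ∀ x, ((ψ x : singularModuliField K ι) : ℂ) = φ x := fun x ↦ rfl
  have hbij : Function.Bijective ψ :=
    ⟨ψ.toRingHom.injective, (LinearMap.injective_iff_surjective (f := ψ.toLinearMap)).mp ψ.toRingHom.injective⟩
  exact ⟨AlgEquiv.ofBijective ψ hbij, fun x ↦ by rw [AlgEquiv.ofBijective_apply, hψ]⟩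

/-- **Every complex embedding of `H_K` has the absolute values of an automorphism**: for `φ : H_K →+* ℂ` there is `σ ∈ Gal(H_K/K)` with
`‖φ x‖ = ‖σ x‖` for all `x` (`φ|_K = ι`: previous lemma; `φ|_K = conj ∘ ι`: apply it to `conj ∘ φ`). [cite: Lang2002, VI §1] -/
theorem exists_algEquiv_norm_eq_of_ringHom (hK : IsImaginaryQuadratic K) (ι : K →+* ℂ)
    (φ : singularModuliField K ι →+* ℂ) :
    ∃ σ : singularModuliField K ι ≃ₐ[K] singularModuliField K ι,
      ∀ x, ‖φ x‖ = ‖((σ x : singularModuliField K ι) : ℂ)‖ := by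
  rcases ringHom_eq_or_eq_conjugate hK ι (φ.comp (algebraMap K (singularModuliField K ι))) with h | h
  · obtain ⟨σ, hσ⟩ := exists_algEquiv_of_ringHom_comp_eq hK ι φ (fun k ↦ RingHom.congr_fun h k)
    exact ⟨σ, fun x ↦ by rw [hσ]⟩
  · -- compose with complex conjugation
    obtain ⟨σ, hσ⟩ := exists_algEquiv_of_ringHom_comp_eq hK ι ((starRingEnd ℂ).comp φ) (fun k ↦ by
      have hk := RingHom.congr_fun h k
      simp only [RingHom.coe_comp, Function.comp_apply] at hk ⊢
      rw [hk, NumberField.ComplexEmbedding.conjugate_coe_eq, Complex.conj_conj])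
    exact ⟨σ, fun x ↦ by rw [← hσ, RingHom.coe_comp, Function.comp_apply, Complex.norm_conj]⟩

end Summit.BirchSwinnertonDyer.BirchSwinnertonDyer.Theorems.GoldfeldGoodTwists

end
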